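import Mathlib
import HarnessLib
import Summits.Parity.GeneralizedHardyLittlewood.Theorems.DilatedChowla.Negative.DilatedChowlaWelch

/-!
# `DilatedChowla` (stmt-Parity-13319): the dilation range is load-bearing — `2M` versus `2^M`

Negative lemmas (cdisprove seat) for the crux `LiouvilleMAD.DilatedChowla` (route LiouvilleMAD,
rank-4 node): for every `c ≠ 0` there are `κ > 0`, `C` with
`|S c n n' M| = |Σ_{m ∈ (M,2M]} λ(mn+c) λ(mn'+c)| ≤ C · M^{1−κ}` for all `M` and all
`1 ≤ n ≠ n' ≤ 2M` (notation `S`, `L` from `DilatedChowlaMirrorDefs` / `DilatedTableChowlaBlocks`;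
the exclusions `c ≠ 0`, `n ≠ n'` are treated in the lead's `DilatedChowlaLoadBearing`).  Here: the
third restriction written into the crux, the DILATION RANGE `n, n' ≤ 2M`, is necessary as well.

* §1 `exists_nat_ge_trivial_gt`: the archimedean step `C · M^{1−κ} < M` for some large `M`.
* §2 `S_shift_zero`: at shift `0` EVERY pair degenerates, `S 0 n n' M = λ(n)λ(n')·M` (complement
  to the lead's witness `S 0 1 4 M = M`).
* §3 The `M`-term sign patterns `(λ(mn+c))_{m ∈ (M,2M]}` take at most `2^M` values, so among any
  `2^M + 1` dilations two patterns coincide and that pair has FULL correlation `S c n n' M = M`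
  (`exists_S_eq_card_of_two_pow_lt`, pigeonhole).  Hence the crux with dilation range `R(M)` in
  place of `2M` (`DilatedChowlaRange R`; the crux is `R M = 2M`, `dilatedChowla_iff_range`, and the
  family is antitone in `R`, `DilatedChowlaRange.anti`) is false as soon as `R(M) > 2^M` for all
  large `M` (`not_dilatedChowlaRange_of_two_pow_lt`, `not_dilatedChowlaRange_two_pow_succ`), and
  so is the range-free variant (`not_dilatedChowlaUnboundedDilations`).  The random model puts the
  first coincidence near `R ≍ 2^{M/2}` (confirmed numerically for `4 ≤ M ≤ 26`: the first
  full-correlation dilation follows the birthday law `√(π/2 · 2^{M−1})` within a factor `2`, and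
  lies outside `2M` from `M = 12` on) and keeps `max_{n ≠ n' ≤ R} |S| ≍ √(M log R)` (kit j017030:
  at `M = 256`, `R = M² = 65536`, `2.1·10⁹` pairs, `max |S|/√M = 6.1–6.3` against the Gaussian
  `6.6`, no full correlation), so every polynomial range `R = M^A` is consistent with the crux; the
  crux's `2M` is the smallest range its consumer (`DilatedChowlaToTypeII`, balanced Type II) needs.

No cited facts; elementary. [folklore]
-/

noncomputable section

namespace Summit.Parity.GeneralizedHardyLittlewood.Theorems.DilatedChowla.Negative

open Summit.Parity.GeneralizedHardyLittlewood.Theses.LiouvilleMAD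
open Summit.Parity.GeneralizedHardyLittlewood.Theorems.DilatedTableChowla.Negative
  (L L_of_pos L_mul_self_of_pos L_natCast L_natCast_mul)
open Finset Filter

/-! ## §1 The archimedean step -/

/-- For `κ > 0` the power bound `C · M^{1-κ}` eventually drops below the trivial size `M`:
there is `M ≥ M₀` with `C · M^{1-κ} < M`. -/
theorem exists_nat_ge_trivial_gt {κ : ℝ} (hκ : 0 < κ) (C : ℝ) (M₀ : ℕ) :
    ∃ M : ℕ, M₀ ≤ M ∧ C * (M : ℝ) ^ (1 - κ) < M := by
  have ht : Tendsto (fun M : ℕ => (M : ℝ) ^ κ) atTop atTop :=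
    (tendsto_rpow_atTop hκ).comp tendsto_natCast_atTop_atTop
  obtain ⟨M, hM0, hMC⟩ :=
    ((eventually_ge_atTop (max M₀ 1)).and (ht.eventually_gt_atTop C)).exists
  refine ⟨M, le_trans (le_max_left _ _) hM0, ?_⟩
  have hM1 : 1 ≤ M := le_trans (le_max_right _ _) hM0
  have hx : (0 : ℝ) < M := by exact_mod_cast hM1
  calc C * (M : ℝ) ^ (1 - κ) < (M : ℝ) ^ κ * (M : ℝ) ^ (1 - κ) :=
        mul_lt_mul_of_pos_right hMC (Real.rpow_pos_of_pos hx _)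
    _ = M := by rw [← Real.rpow_add hx, add_sub_cancel, Real.rpow_one]

/-! ## §2 At shift zero every pair degenerates -/

/-- **No cancellation at shift zero.** By complete multiplicativity `λ(mn) λ(mn') = λ(n) λ(n')`
for `m ≥ 1`, so `S 0 n n' M = λ(n) λ(n') · M` for EVERY pair of dilations. -/
theorem S_shift_zero (n n' M : ℕ) : S 0 n n' M = L n * L n' * M := by
  unfold S
  have hcard : (Ioc M (2 * M)).card = M := by rw [Nat.card_Ioc]; omega
  calc ∑ m ∈ Ioc M (2 * M), L ((m : ℤ) * n + 0) * L ((m : ℤ) * n' + 0)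
      = ∑ _m ∈ Ioc M (2 * M), L n * L n' := by
        refine sum_congr rfl fun m hm => ?_
        rw [add_zero, add_zero, L_natCast_mul, L_natCast_mul]
        have hm0 : (0 : ℤ) < (m : ℕ) := by
          rw [mem_Ioc] at hm
          exact_mod_cast (show 0 < m by omega)
        linear_combination (L n * L n') * L_mul_self_of_pos hm0
    _ = L n * L n' * M := by rw [sum_const, hcard, nsmul_eq_mul]; ring

/-! ## §3 The dilation range: `2M` versus `2^M` -/

/-- On positive arguments `L` is a sign. -/
theorem L_eq_one_or {a : ℤ} (ha : 0 < a) : L a = 1 ∨ L a = -1 := by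
  rw [L_of_pos ha]; exact neg_one_pow_eq_or ℝ _

/-- Two signs with the same indicator of `= 1` are equal. -/
theorem L_eq_of_iff {a b : ℤ} (ha : 0 < a) (hb : 0 < b) (h : L a = 1 ↔ L b = 1) : L a = L b := by
  rcases L_eq_one_or ha with h1 | h1 <;> rcases L_eq_one_or hb with h2 | h2
  · rw [h1, h2]
  · exact absurd (h.mp h1) (by rw [h2]; norm_num)
  · exact absurd (h.mpr h2) (by rw [h1]; norm_num)
  · rw [h1, h2]

/-- Two dilations whose sign patterns on `(M,2M]` coincide have FULL correlation `S c n n' M = M`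
(positivity of the arguments from `|c| < M`, `arg_pos`). -/
theorem S_eq_card_of_pattern_eq {c : ℤ} {M n n' : ℕ} (hcM : |c| < (M : ℤ)) (hn : 1 ≤ n)
    (hn' : 1 ≤ n')
    (h : ∀ m ∈ Ioc M (2 * M), (L ((m : ℤ) * n + c) = 1 ↔ L ((m : ℤ) * n' + c) = 1)) :
    S c n n' M = M := by
  unfold S
  have hcard : (Ioc M (2 * M)).card = M := by rw [Nat.card_Ioc]; omega
  calc ∑ m ∈ Ioc M (2 * M), L ((m : ℤ) * n + c) * L ((m : ℤ) * n' + c)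
      = ∑ _m ∈ Ioc M (2 * M), (1 : ℝ) := by
        refine sum_congr rfl fun m hm => ?_
        have hMm : M < m := (mem_Ioc.mp hm).1
        rw [← L_eq_of_iff (arg_pos hcM hn hMm) (arg_pos hcM hn' hMm) (h m hm)]
        exact L_mul_self_of_pos (arg_pos hcM hn hMm)
    _ = M := by rw [sum_const, hcard, nsmul_eq_mul, mul_one]

/-- **Pigeonhole on sign patterns.** The patterns `m ↦ [λ(mn+c) = 1]` on `(M,2M]` take at most
`2^M` values, so among the dilations `1 ≤ n ≤ R` with `R > 2^M` two distinct ones share a pattern,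
and that pair has no cancellation: `S c n n' M = M` (for `|c| < M`). -/
theorem exists_S_eq_card_of_two_pow_lt {c : ℤ} {M : ℕ} (hcM : |c| < (M : ℤ)) {R : ℕ}
    (hR : 2 ^ M < R) :
    ∃ n n' : ℕ, 1 ≤ n ∧ 1 ≤ n' ∧ n ≠ n' ∧ n ≤ R ∧ n' ≤ R ∧ S c n n' M = M := by
  classical
  let φ : ℕ → (Ioc M (2 * M) → Bool) := fun n m => decide (L ((m : ℤ) * n + c) = 1)
  have hmaps : ∀ n ∈ Icc 1 R, φ n ∈ (univ : Finset (Ioc M (2 * M) → Bool)) :=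
    fun _ _ => mem_univ _
  have hcard : (univ : Finset (Ioc M (2 * M) → Bool)).card < (Icc 1 R).card := by
    rw [card_univ, Fintype.card_fun, Fintype.card_bool, Fintype.card_coe, Nat.card_Ioc,
      Nat.card_Icc, show 2 * M - M = M by omega]
    omega
  obtain ⟨n, hn, n', hn', hne, heq⟩ := exists_ne_map_eq_of_card_lt_of_maps_to hcard hmaps
  rw [mem_Icc] at hn hn'
  refine ⟨n, n', hn.1, hn'.1, hne, hn.2, hn'.2, S_eq_card_of_pattern_eq hcM hn.1 hn'.1 ?_⟩
  intro m hm
  have := congr_fun heq ⟨m, hm⟩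
  simpa [φ] using this

/-- The crux with dilation range `R(M)` in place of `2M`. -/
def DilatedChowlaRange (R : ℕ → ℕ) : Prop :=
  ∀ c : ℤ, c ≠ 0 → ∃ κ : ℝ, 0 < κ ∧ ∃ C : ℝ, ∀ M n n' : ℕ, 1 ≤ n → 1 ≤ n' → n ≠ n' →
    n ≤ R M → n' ≤ R M → |S c n n' M| ≤ C * (M : ℝ) ^ (1 - κ)

/-- READ-BACK: the crux is the range `R M = 2M` (definitional). -/
theorem dilatedChowla_iff_range : DilatedChowla ↔ DilatedChowlaRange (fun M => 2 * M) := Iff.rfl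

/-- The family is antitone in the range: a larger range is a stronger statement. -/
theorem DilatedChowlaRange.anti {R R' : ℕ → ℕ} (hle : ∀ M, R M ≤ R' M) (h : DilatedChowlaRange R') :
    DilatedChowlaRange R := by
  intro c hc
  obtain ⟨κ, hκ, C, hC⟩ := h c hc
  exact ⟨κ, hκ, C, fun M n n' hn hn' hne h2 h2' =>
    hC M n n' hn hn' hne (le_trans h2 (hle M)) (le_trans h2' (hle M))⟩

/-- **Exponential dilation ranges are false.** If `R(M) > 2^M` for all large `M`, the crux with
range `R` fails at `c = 1`: pigeonhole gives a pair with `|S 1 n n' M| = M > C · M^{1-κ}`. -/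
theorem not_dilatedChowlaRange_of_two_pow_lt {R : ℕ → ℕ} {M₀ : ℕ}
    (hR : ∀ M, M₀ ≤ M → 2 ^ M < R M) : ¬ DilatedChowlaRange R := by
  intro h
  obtain ⟨κ, hκ, C, hC⟩ := h 1 one_ne_zero
  obtain ⟨M, hM, hlt⟩ := exists_nat_ge_trivial_gt hκ C (max M₀ 2)
  have hM0 : M₀ ≤ M := le_trans (le_max_left _ _) hM
  have hM2 : 2 ≤ M := le_trans (le_max_right _ _) hM
  have hcM : |(1 : ℤ)| < (M : ℤ) := by rw [abs_one]; exact_mod_cast hM2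
  obtain ⟨n, n', hn, hn', hne, hnR, hn'R, hS⟩ := exists_S_eq_card_of_two_pow_lt hcM (hR M hM0)
  have key := hC M n n' hn hn' hne hnR hn'R
  rw [hS, abs_of_nonneg (Nat.cast_nonneg M)] at key
  linarith

/-- In particular the range `2^M + 1` is false (the crux's range is `2M`). -/
theorem not_dilatedChowlaRange_two_pow_succ : ¬ DilatedChowlaRange (fun M => 2 ^ M + 1) :=
  not_dilatedChowlaRange_of_two_pow_lt (M₀ := 0) fun _ _ => Nat.lt_succ_self _

/-- The crux with NO dilation range (all `1 ≤ n ≠ n'`). -/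
def DilatedChowlaUnboundedDilations : Prop :=
  ∀ c : ℤ, c ≠ 0 → ∃ κ : ℝ, 0 < κ ∧ ∃ C : ℝ, ∀ M n n' : ℕ, 1 ≤ n → 1 ≤ n' → n ≠ n' →
    |S c n n' M| ≤ C * (M : ℝ) ^ (1 - κ)

/-- The range-free variant implies every ranged one (in particular the crux). -/
theorem dilatedChowlaRange_of_unbounded (R : ℕ → ℕ) (h : DilatedChowlaUnboundedDilations) :
    DilatedChowlaRange R := by
  intro c hc
  obtain ⟨κ, hκ, C, hC⟩ := h c hc
  exact ⟨κ, hκ, C, fun M n n' hn hn' hne _ _ => hC M n n' hn hn' hne⟩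

/-- **The dilation range is load-bearing.** With no range at all the crux is false. -/
theorem not_dilatedChowlaUnboundedDilations : ¬ DilatedChowlaUnboundedDilations :=
  fun h => not_dilatedChowlaRange_two_pow_succ (dilatedChowlaRange_of_unbounded _ h)

end Summit.Parity.GeneralizedHardyLittlewood.Theorems.DilatedChowla.Negative

end
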